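import Mathlib.Analysis.Calculus.ParametricIntegral
import Mathlib.MeasureTheory.Function.SpecialFunctions.Inner
import Mathlib.MeasureTheory.Function.StronglyMeasurable.Inner
import Literature.Analysis.FluidPDE.BiotSavart2DSymmetry
import Literature.Analysis.FluidPDE.GaussianVortexPlanarLinear

/-!
# The axisymmetric Burgers vortex `αG` solves the strained vorticity equation (4.2) weakly

Proof file for the named fact `GallayMaekawa2016_thm41` of
`Literature.Analysis.FluidPDE.GaussianVortexPlanar` (work unit `provefact GallayMaekawa2016_thm41`;
the CLASSICAL `λ = 0` statement for `GallayWayne2006_thm11` is `GaussianVortexPlanarProofs`). Gallay–Maekawa 2016, §4 (PDF p. 15): "When `λ = 0`,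
Eq. (4.2) has the explicit solution `ω = αG`, which is the classical axisymmetric Burgers vortex
with circulation `α`." We PROVE this in the distributional formulation `IsWeakAsymBurgersVortex`
of (4.2) used by the named fact `GallayMaekawa2016_thm41`, together with `αG ∈ L²(∞;0)`: this is
the `λ = 0` slice of Gallay–Maekawa's Theorem 4.1 (`gallayMaekawa2016_thm41_lam_zero`); the
trivial `α = 0` slice (`ω = 0`, any `λ`) is `gallayMaekawa2016_thm41_alpha_zero`. The general case
`0 < λ < 1`, `α ≠ 0` (Maekawa 2009, Leray–Schauder in `L²(∞;λ)`) is NOT proved here.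

## The argument

* Linear part `∫ G (Δφ − ½ x·∇φ) = 0`: `GaussianVortexPlanarLinear` (`LG = 0` by parts).
* Nonlinear part `∫ w ⟪K_{2D} ∗ w, ∇φ⟫ = 0` for every RADIAL bounded integrable continuous `w`
  (`integral_mul_inner_biotSavart2D_gradient_eq_zero`, i.e. radial vortices are weakly stationary
  2D Euler flows): by `BiotSavart2DSymmetry`, `v = K_{2D} ∗ w = c x^⊥` with `ψ = w c` rotation
  invariant and `|ψ| ≤ AM‖x‖⁻¹`, so `w⟪v, ∇φ⟫ = ψ ∂_θφ`; the function
  `t ↦ ∫ ψ(x) φ(R_t x) dx` is constant in `t` (change of variables under the rotation `R_t`) and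
  its derivative at `t = 0` is `∫ ψ ∂_θφ` (differentiation under the integral sign,
  `hasDerivAt_integral_of_dominated_loc_of_deriv_le`, dominated by `AM‖Dφ‖_∞ 𝟙_{disc}`), hence
  `∫ ψ ∂_θφ = 0`. No explicit evaluation of `K_{2D} ∗ G` is used.
* Assembly: `w = αG` is radial, smooth, bounded by `|α|/(4π)`, of integral `α`; `w v ∈ L¹`
  by the uniform bound on `v`; `(αG)²/G₀ = α²G ∈ L¹`.

## References

* Th. Gallay, Y. Maekawa, *Existence and stability of viscous vortices*, arXiv:1610.08384, §4,
  (4.2)–(4.3) and the sentence after (4.3) (PDF p. 15); Thm. 4.1 (p. 16). [GallayMaekawa2016]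
* Th. Gallay, C. E. Wayne, *Existence and stability of asymmetric Burgers vortices*,
  J. Math. Fluid Mech. 9 (2007), §1, (1.5), (1.7)–(1.8). [GallayWayne2006]
* Y. Maekawa, *Existence of asymmetric Burgers vortices and their asymptotic behavior at large
  circulations*, Math. Models Methods Appl. Sci. 19 (2009) 669–705 (the general case).
-/

noncomputable section

open Set Function Filter MeasureTheory Metric
open scoped Laplacian InnerProductSpace RealInnerProductSpace ContDiff Topology

namespace Literature.Analysis.FluidPDE

/-! ### Private copies of four lemmas of `GaussianVortexPlanarProofs`

(kept private so that this file does not depend on that module). -/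

/-- `|ξ^⊥| = |ξ|`. [folklore] -/
private theorem norm_perp_aux (z : EuclideanSpace ℝ (Fin 2)) : ‖perp z‖ = ‖z‖ := by
  simp only [EuclideanSpace.norm_eq, Fin.sum_univ_two, perp_apply_zero, perp_apply_one, norm_neg]
  rw [add_comm]

/-- `ξ ↦ ξ^⊥` is continuous. [folklore] -/
private theorem continuous_perp_aux : Continuous perp :=
  ({ toFun := perp, map_add' := perp_add, map_smul' := perp_smul } :
      EuclideanSpace ℝ (Fin 2) →ₗ[ℝ] EuclideanSpace ℝ (Fin 2)).continuous_of_finiteDimensional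

/-- `G` is integrable. [folklore] -/
private theorem integrable_gaussVortexProfile_aux : Integrable gaussVortexProfile :=
  Integrable.of_integral_ne_zero (by rw [integral_gaussVortexProfile]; exact one_ne_zero)

/-- `G ≤ G(0) = (4π)⁻¹`. [folklore] -/
private theorem gaussVortexProfile_le_aux (y : EuclideanSpace ℝ (Fin 2)) :
    gaussVortexProfile y ≤ (4 * Real.pi)⁻¹ := by
  unfold gaussVortexProfile
  have h : Real.exp (-(‖y‖ ^ 2 / 4)) ≤ 1 :=
    Real.exp_le_one_iff.2 (neg_nonpos.2 (by positivity))
  calc (4 * Real.pi)⁻¹ * Real.exp (-(‖y‖ ^ 2 / 4)) ≤ (4 * Real.pi)⁻¹ * 1 := by gcongr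
    _ = (4 * Real.pi)⁻¹ := mul_one _

/-! ### Rotations by an angle and the angular derivative -/

/-- `‖cos t · x + sin t · x^⊥‖ = ‖x‖`. [folklore] -/
theorem norm_cos_smul_add_sin_smul_perp (t : ℝ) (x : EuclideanSpace ℝ (Fin 2)) :
    ‖Real.cos t • x + Real.sin t • perp x‖ = ‖x‖ := by
  obtain ⟨R, hR⟩ := exists_planarRotation (Real.cos t) (Real.sin t) (Real.cos_sq_add_sin_sq t)
  rw [← hR, LinearIsometryEquiv.norm_map]

/-- Lebesgue measure on `ℝ²` is rotation invariant: `∫ g(R_t x) dx = ∫ g`. [folklore] -/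
theorem integral_comp_rotation (t : ℝ) (g : EuclideanSpace ℝ (Fin 2) → ℝ) :
    ∫ x, g (Real.cos t • x + Real.sin t • perp x) = ∫ x, g x := by
  obtain ⟨R, hR⟩ := exists_planarRotation (Real.cos t) (Real.sin t) (Real.cos_sq_add_sin_sq t)
  simp_rw [← hR]
  exact R.measurePreserving.integral_comp R.toHomeomorph.measurableEmbedding g

/-- `t ↦ R_t x = cos t · x + sin t · x^⊥` has velocity `(R_t x)^⊥`. [folklore] -/
theorem hasDerivAt_rotation_curve (x : EuclideanSpace ℝ (Fin 2)) (t : ℝ) :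
    HasDerivAt (fun s => Real.cos s • x + Real.sin s • perp x)
      (perp (Real.cos t • x + Real.sin t • perp x)) t := by
  have h := ((Real.hasDerivAt_cos t).smul_const x).add
    ((Real.hasDerivAt_sin t).smul_const (perp x))
  refine h.congr_deriv ?_
  rw [perp_add, perp_smul, perp_smul, perp_perp, smul_neg, neg_smul]
  abel

/-- `⟪u, ∇φ(x)⟫ = Dφ(x) u`. [folklore] -/
theorem inner_gradient_right (φ : EuclideanSpace ℝ (Fin 2) → ℝ) (x u : EuclideanSpace ℝ (Fin 2)) :
    ⟪u, gradient φ x⟫ = fderiv ℝ φ x u := by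
  rw [real_inner_comm, gradient, InnerProductSpace.toDual_symm_apply]

/-- The azimuthal coefficient `c(x) = ⟪v(x), x^⊥⟫/‖x‖²` is measurable. [folklore] -/
theorem measurable_azimuthalCoeff {w : EuclideanSpace ℝ (Fin 2) → ℝ} (hw : Measurable w) :
    Measurable fun x => ⟪biotSavart2D w x, perp x⟫ / ‖x‖ ^ 2 :=
  (Measurable.inner (stronglyMeasurable_biotSavart2D hw).measurable
    continuous_perp_aux.measurable).div (measurable_norm.pow_const 2)

/-! ### The nonlinear part: `∫ w ⟪K_{2D} ∗ w, ∇φ⟫ = 0` for radial `w` -/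

section Radial

variable {w : EuclideanSpace ℝ (Fin 2) → ℝ}
  (hw : ∀ (T : EuclideanSpace ℝ (Fin 2) ≃ₗᵢ[ℝ] EuclideanSpace ℝ (Fin 2)) (y), w (T y) = w y)
  (hwc : Continuous w) (hwi : Integrable w) {A : ℝ} (hA : ∀ y, |w y| ≤ A)

include hwi hA in
/-- `|w(x) c(x)| ≤ A M ‖x‖⁻¹` with the uniform velocity bound `M` of `norm_biotSavart2D_le`.
[folklore] -/
theorem abs_mul_azimuthalCoeff_le (x : EuclideanSpace ℝ (Fin 2)) :
    |w x * (⟪biotSavart2D w x, perp x⟫ / ‖x‖ ^ 2)| ≤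
      A * ((2 * Real.pi)⁻¹ * (A * (∫ z, indicator (ball (0 : EuclideanSpace ℝ (Fin 2)) 1)
        (fun z => ‖z‖⁻¹) z) + ∫ y, |w y|)) * ‖x‖⁻¹ := by
  by_cases hx : x = 0
  · subst hx; simp
  have hn : 0 < ‖x‖ := norm_pos_iff.2 hx
  rw [le_mul_inv_iff₀ hn, abs_mul, mul_assoc]
  exact mul_le_mul (hA x) ((abs_azimuthalCoeff_mul_norm_le _ x).trans
    (norm_biotSavart2D_le hwi hA x)) (by positivity) ((abs_nonneg _).trans (hA x))

include hw hwc hwi hA in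
/-- **Radial vortices are weakly stationary for 2D Euler**: for a radial, continuous, bounded,
integrable vorticity `w` with velocity `v = K_{2D} ∗ w` and every test function `φ`,
`∫ w ⟪v, ∇φ⟫ = 0`. Proof: `w ⟪v, ∇φ⟫ = ψ ∂_θφ` with `ψ = w c` rotation invariant, and
`t ↦ ∫ ψ(x) φ(R_t x) dx` is constant (change of variables) with derivative `∫ ψ ∂_θφ` at `t = 0`
(differentiation under the integral sign). [folklore] -/
theorem integral_mul_inner_biotSavart2D_gradient_eq_zero {φ : EuclideanSpace ℝ (Fin 2) → ℝ}
    (hφ : ContDiff ℝ ∞ φ) (hφc : HasCompactSupport φ) :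
    ∫ x, w x * ⟪biotSavart2D w x, gradient φ x⟫ = 0 := by
  -- notation: `ψ = w c`, the velocity bound `M`, the rotations `rot t`
  set ψ : EuclideanSpace ℝ (Fin 2) → ℝ := fun x => w x * (⟪biotSavart2D w x, perp x⟫ / ‖x‖ ^ 2)
    with hψ_def
  set M : ℝ := (2 * Real.pi)⁻¹ * (A * (∫ z, indicator (ball (0 : EuclideanSpace ℝ (Fin 2)) 1)
    (fun z => ‖z‖⁻¹) z) + ∫ y, |w y|) with hM_def
  set rot : ℝ → EuclideanSpace ℝ (Fin 2) → EuclideanSpace ℝ (Fin 2) :=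
    fun t x => Real.cos t • x + Real.sin t • perp x with hrot_def
  have hA0 : 0 ≤ A := (abs_nonneg _).trans (hA 0)
  have hM0 : 0 ≤ M := mul_nonneg (by positivity) (add_nonneg
    (mul_nonneg hA0 (integral_nonneg indicator_inv_norm_nonneg))
    (integral_nonneg fun _ => abs_nonneg _))
  have hψm : Measurable ψ := hwc.measurable.mul (measurable_azimuthalCoeff hwc.measurable)
  have hψrot : ∀ t x, ψ (rot t x) = ψ x := fun t x => by
    obtain ⟨R, hR⟩ := exists_planarRotation (Real.cos t) (Real.sin t) (Real.cos_sq_add_sin_sq t)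
    simp only [hψ_def, hrot_def, ← hR]
    rw [hw, azimuthalCoeff_rotation_of_radial hw hR]
  have hψle : ∀ x, |ψ x| ≤ A * M * ‖x‖⁻¹ := fun x => abs_mul_azimuthalCoeff_le hwi hA x
  have hψle' : ∀ x, |ψ x| * ‖x‖ ≤ A * M := fun x => by
    rw [hψ_def, abs_mul, mul_assoc]
    exact mul_le_mul (hA x) ((abs_azimuthalCoeff_mul_norm_le _ x).trans
      (norm_biotSavart2D_le hwi hA x)) (by positivity) hA0
  have hrotc : ∀ t, Continuous (rot t) := fun t =>
    ((continuous_const (y := Real.cos t)).smul continuous_id).add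
      ((continuous_const (y := Real.sin t)).smul continuous_perp_aux)
  have hrot0 : ∀ x, rot 0 x = x := fun x => by simp [hrot_def]
  -- Step 1: the integrand is `ψ ∂_θ φ`
  have hintegrand : ∀ x, w x * ⟪biotSavart2D w x, gradient φ x⟫ =
      ψ x * fderiv ℝ φ x (perp x) := by
    intro x
    rw [biotSavart2D_eq_smul_perp_of_radial hw x, inner_smul_left, inner_gradient_right,
      hψ_def, RCLike.conj_to_real, mul_assoc]
  simp_rw [hintegrand]
  -- support radius and bounds for `φ`, `Dφ`
  obtain ⟨ρ, hρ⟩ := hφc.isCompact.isBounded.subset_ball 0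
  obtain ⟨C₀, hC₀⟩ := hφ.continuous.bounded_above_of_compact_support hφc
  obtain ⟨C₁, hC₁⟩ := (hφ.continuous_fderiv (by simp)).bounded_above_of_compact_support
    (hφc.fderiv (𝕜 := ℝ))
  have hC₁' : 0 ≤ C₁ := (norm_nonneg _).trans (hC₁ 0)
  have hout : ∀ t x, ρ ≤ ‖x‖ → rot t x ∉ tsupport φ := fun t x hx hmem => by
    have := hρ hmem
    rw [mem_ball_zero_iff, hrot_def, norm_cos_smul_add_sin_smul_perp] at this
    linarith
  -- the family `F t x = ψ x φ(R_t x)` and its `t`-derivative `F'`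
  set F : ℝ → EuclideanSpace ℝ (Fin 2) → ℝ := fun t x => ψ x * φ (rot t x) with hF_def
  set F' : ℝ → EuclideanSpace ℝ (Fin 2) → ℝ :=
    fun t x => ψ x * fderiv ℝ φ (rot t x) (perp (rot t x)) with hF'_def
  have hF_meas : ∀ t, AEStronglyMeasurable (F t) volume := fun t =>
    (hψm.mul (hφ.continuous.comp (hrotc t)).measurable).aestronglyMeasurable
  have hF'_meas : ∀ t, AEStronglyMeasurable (F' t) volume := fun t =>
    (hψm.mul (((hφ.continuous_fderiv (by simp)).comp (hrotc t)).clm_apply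
      (continuous_perp_aux.comp (hrotc t))).measurable).aestronglyMeasurable
  have hF_int : ∀ t, Integrable (F t) := by
    intro t
    refine Integrable.mono'
      (g := fun x => A * M * C₀ * indicator (ball 0 ρ) (fun z => ‖z‖⁻¹) x)
      (((integrableOn_inv_norm_ball ρ).integrable_indicator measurableSet_ball).const_mul _)
      (hF_meas t) (Eventually.of_forall fun x => ?_)
    by_cases hx : ‖x‖ < ρ
    · rw [indicator_of_mem (mem_ball_zero_iff.2 hx), hF_def]
      simp only [norm_mul, Real.norm_eq_abs]
      calc |ψ x| * |φ (rot t x)| ≤ A * M * ‖x‖⁻¹ * C₀ :=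
            mul_le_mul (hψle x) (hC₀ _) (abs_nonneg _)
              (mul_nonneg (mul_nonneg hA0 hM0) (inv_nonneg.2 (norm_nonneg _)))
        _ = A * M * C₀ * ‖x‖⁻¹ := by ring
    · have h0 : φ (rot t x) = 0 := image_eq_zero_of_notMem_tsupport (hout t x (not_lt.1 hx))
      rw [indicator_of_notMem (by rwa [mem_ball_zero_iff]), hF_def]
      simp [h0]
  have h_bound : ∀ᵐ x ∂volume, ∀ t ∈ (univ : Set ℝ),
      ‖F' t x‖ ≤ indicator (ball 0 ρ) (fun _ => A * M * C₁) x := by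
    refine Eventually.of_forall fun x t _ => ?_
    by_cases hx : ‖x‖ < ρ
    · rw [indicator_of_mem (mem_ball_zero_iff.2 hx), hF'_def]
      simp only [norm_mul, Real.norm_eq_abs]
      calc |ψ x| * |fderiv ℝ φ (rot t x) (perp (rot t x))|
          ≤ |ψ x| * (C₁ * ‖x‖) := by
            refine mul_le_mul_of_nonneg_left ?_ (abs_nonneg _)
            calc |fderiv ℝ φ (rot t x) (perp (rot t x))|
                ≤ ‖fderiv ℝ φ (rot t x)‖ * ‖perp (rot t x)‖ :=
                  (Real.norm_eq_abs _).symm.le.trans (ContinuousLinearMap.le_opNorm _ _)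
              _ ≤ C₁ * ‖x‖ := by
                  rw [norm_perp_aux, hrot_def, norm_cos_smul_add_sin_smul_perp]
                  exact mul_le_mul_of_nonneg_right (hC₁ _) (norm_nonneg _)
        _ = |ψ x| * ‖x‖ * C₁ := by ring
        _ ≤ A * M * C₁ := mul_le_mul_of_nonneg_right (hψle' x) hC₁'
    · have h0 : fderiv ℝ φ (rot t x) = 0 :=
        fderiv_of_notMem_tsupport ℝ (hout t x (not_lt.1 hx))
      rw [indicator_of_notMem (by rwa [mem_ball_zero_iff]), hF'_def]
      simp [h0]
  have h_diff : ∀ᵐ x ∂volume, ∀ t ∈ (univ : Set ℝ),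
      HasDerivAt (fun s => F s x) (F' t x) t := by
    refine Eventually.of_forall fun x t _ => ?_
    simp only [hF_def, hF'_def, hrot_def]
    exact ((hφ.differentiable (by simp) _).hasFDerivAt.comp_hasDerivAt t
      (hasDerivAt_rotation_curve x t)).const_mul (ψ x)
  have hD := (hasDerivAt_integral_of_dominated_loc_of_deriv_le (μ := volume) (x₀ := (0 : ℝ))
    univ_mem (Eventually.of_forall hF_meas) (hF_int 0) (hF'_meas 0) h_bound
    ((integrableOn_const (by exact measure_ball_lt_top.ne)).integrable_indicator
      measurableSet_ball) h_diff).2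
  -- Step 2: `t ↦ ∫ F t` is constant (rotation invariance of `ψ` and of Lebesgue measure)
  have hconst : (fun t => ∫ x, F t x) = fun _ => ∫ x, ψ x * φ x := by
    funext t
    simp only [hF_def]
    calc ∫ x, ψ x * φ (rot t x) = ∫ x, ψ (rot t x) * φ (rot t x) := by simp_rw [hψrot]
      _ = ∫ y, ψ y * φ y := integral_comp_rotation t (fun y => ψ y * φ y)
  rw [hconst] at hD
  have h0 := (hasDerivAt_const (0 : ℝ) (∫ x, ψ x * φ x)).unique hD
  -- Step 3: identify the derivative at `t = 0`
  have : (fun x => F' 0 x) = fun x => ψ x * fderiv ℝ φ x (perp x) := by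
    funext x; simp only [hF'_def, hrot0]
  rw [this] at h0
  exact h0.symm

end Radial

/-! ### Assembly: the `λ = 0` and `α = 0` slices of Gallay–Maekawa's Theorem 4.1 -/

/-- **The trivial vortex.** For every asymmetry `λ`, `ω = 0` is a weak asymmetric Burgers vortex
with circulation `0`. [folklore] -/
theorem isWeakAsymBurgersVortex_zero (lam : ℝ) : IsWeakAsymBurgersVortex lam 0 (fun _ => 0) := by
  refine ⟨integrable_zero _ _ _, by simp, ?_, fun φ _ _ => by simp⟩
  simp only [zero_smul]
  exact locallyIntegrable_zero

/-- `0 ∈ L²(∞;λ)`. [folklore] -/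
theorem memL2InftyLam_zero (lam : ℝ) : MemL2InftyLam lam (fun _ => 0) :=
  ⟨aestronglyMeasurable_const, by simp⟩

/-- **The axisymmetric Burgers vortex `αG` is a weak Burgers vortex for `λ = 0`** with
circulation `α` (Gallay–Maekawa 2016, the sentence after (4.3): "When `λ = 0`, Eq. (4.2) has the
explicit solution `ω = αG`"). [cite: GallayMaekawa2016, (4.2)–(4.3)] -/
theorem isWeakAsymBurgersVortex_gaussian (α : ℝ) :
    IsWeakAsymBurgersVortex 0 α (fun x => α * gaussVortexProfile x) := by
  set w : EuclideanSpace ℝ (Fin 2) → ℝ := fun x => α * gaussVortexProfile x with hw_def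
  have hwr : ∀ (T : EuclideanSpace ℝ (Fin 2) ≃ₗᵢ[ℝ] EuclideanSpace ℝ (Fin 2)) (y), w (T y) = w y :=
    fun T y => by simp [hw_def, gaussVortexProfile]
  have hwc : Continuous w := continuous_const.mul (contDiff_gaussVortexProfile (n := 0)).continuous
  have hwi : Integrable w := integrable_gaussVortexProfile_aux.const_mul α
  have hA : ∀ y, |w y| ≤ |α| * (4 * Real.pi)⁻¹ := fun y => by
    rw [hw_def, abs_mul, abs_of_pos (gaussVortexProfile_pos y)]
    exact mul_le_mul_of_nonneg_left (gaussVortexProfile_le_aux y) (abs_nonneg α)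
  set M : ℝ := (2 * Real.pi)⁻¹ * (|α| * (4 * Real.pi)⁻¹ *
    (∫ z, indicator (ball (0 : EuclideanSpace ℝ (Fin 2)) 1) (fun z => ‖z‖⁻¹) z) + ∫ y, |w y|)
    with hM_def
  have hvM : ∀ x, ‖biotSavart2D w x‖ ≤ M := norm_biotSavart2D_le hwi hA
  have hvm : AEStronglyMeasurable (biotSavart2D w) volume :=
    (stronglyMeasurable_biotSavart2D hwc.measurable).aestronglyMeasurable
  refine ⟨hwi, ?_, ?_, ?_⟩
  · -- circulation `∫ αG = α`
    rw [hw_def]; simp only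
    rw [integral_const_mul, integral_gaussVortexProfile, mul_one]
  · -- `w v ∈ L¹ ⊆ L¹_loc`
    refine Integrable.locallyIntegrable ?_
    refine Integrable.mono' (g := fun x => |w x| * M) (hwi.abs.mul_const M)
      (hwc.aestronglyMeasurable.smul hvm) (Eventually.of_forall fun x => ?_)
    rw [norm_smul, Real.norm_eq_abs]
    exact mul_le_mul_of_nonneg_left (hvM x) (abs_nonneg _)
  · -- the weak equation: linear part (`LG = 0`) + nonlinear part (radial symmetry)
    intro φ hφ hφc
    obtain ⟨C, hC⟩ := (continuous_gradient_fin_two hφ).bounded_above_of_compact_support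
      (hasCompactSupport_gradient_fin_two hφc)
    have h1 : Integrable fun x : EuclideanSpace ℝ (Fin 2) => w x * (Δ φ x -
        ((1 + 0) / 2 * x 0 * fderiv ℝ φ x (EuclideanSpace.single 0 1) +
          (1 - 0) / 2 * x 1 * fderiv ℝ φ x (EuclideanSpace.single 1 1))) :=
      (hwc.mul ((continuous_laplacian_fin_two hφ).sub (continuous_adjointDrift hφ 0)))
        |>.integrable_of_hasCompactSupport
        (((hasCompactSupport_laplacian_fin_two hφ hφc).sub (hasCompactSupport_adjointDrift hφc 0)).mul_left)
    have h2 : Integrable fun x => w x * ⟪biotSavart2D w x, gradient φ x⟫ := by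
      refine Integrable.mono' (g := fun x => |w x| * (M * C)) (hwi.abs.mul_const _)
        (hwc.aestronglyMeasurable.mul (AEStronglyMeasurable.inner hvm
          (continuous_gradient_fin_two hφ).aestronglyMeasurable))
        (Eventually.of_forall fun x => ?_)
      rw [norm_mul, Real.norm_eq_abs]
      refine mul_le_mul_of_nonneg_left ?_ (abs_nonneg _)
      exact (abs_real_inner_le_norm _ _).trans (mul_le_mul (hvM x) (hC x) (norm_nonneg _)
        ((norm_nonneg _).trans (hvM x)))
    simp_rw [mul_add]
    rw [integral_add h1 h2, integral_mul_inner_biotSavart2D_gradient_eq_zero hwr hwc hwi hA hφ hφc,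
      add_zero]
    have h3 : (fun x : EuclideanSpace ℝ (Fin 2) => w x * (Δ φ x -
        ((1 + 0) / 2 * x 0 * fderiv ℝ φ x (EuclideanSpace.single 0 1) +
          (1 - 0) / 2 * x 1 * fderiv ℝ φ x (EuclideanSpace.single 1 1)))) =
        fun x => α * (gaussVortexProfile x * (Δ φ x -
          ((1 + 0) / 2 * x 0 * fderiv ℝ φ x (EuclideanSpace.single 0 1) +
            (1 - 0) / 2 * x 1 * fderiv ℝ φ x (EuclideanSpace.single 1 1)))) := by
      funext x; rw [hw_def]; ring
    rw [h3, integral_const_mul, integral_gauss_mul_adjointL hφ hφc 0 rfl, mul_zero]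

/-- `αG ∈ L²(∞;0)` (indeed `(αG)²/G₀ = α²G`). [folklore] -/
theorem memL2InftyLam_gaussian (α : ℝ) : MemL2InftyLam 0 (fun x => α * gaussVortexProfile x) := by
  refine ⟨(continuous_const.mul (contDiff_gaussVortexProfile (n := 0)).continuous)
    |>.aestronglyMeasurable, ?_⟩
  have : (fun x : EuclideanSpace ℝ (Fin 2) => (α * gaussVortexProfile x) ^ 2 / gaussWeightLam 0 x) =
      fun x => α ^ 2 * gaussVortexProfile x := by
    funext x
    rw [gaussWeightLam_zero]
    have := (gaussVortexProfile_pos x).ne'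
    field_simp
  rw [this]
  exact integrable_gaussVortexProfile_aux.const_mul _

/-- **Gallay–Maekawa 2016, Theorem 4.1, the slice `λ = 0`** (proved): for every circulation `α`
the axisymmetric Burgers vortex `αG ∈ L²(∞;0)` solves (4.2) weakly.
[cite: GallayMaekawa2016, Thm. 4.1] -/
theorem gallayMaekawa2016_thm41_lam_zero (α : ℝ) :
    ∃ w : EuclideanSpace ℝ (Fin 2) → ℝ, IsWeakAsymBurgersVortex 0 α w ∧ MemL2InftyLam 0 w :=
  ⟨_, isWeakAsymBurgersVortex_gaussian α, memL2InftyLam_gaussian α⟩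

/-- **Gallay–Maekawa 2016, Theorem 4.1, the slice `α = 0`** (proved, trivially: `ω = 0`).
[cite: GallayMaekawa2016, Thm. 4.1] -/
theorem gallayMaekawa2016_thm41_alpha_zero (lam : ℝ) :
    ∃ w : EuclideanSpace ℝ (Fin 2) → ℝ, IsWeakAsymBurgersVortex lam 0 w ∧ MemL2InftyLam lam w :=
  ⟨_, isWeakAsymBurgersVortex_zero lam, memL2InftyLam_zero lam⟩

end Literature.Analysis.FluidPDE
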